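import Summits.Ventures.YMGap.RobustBall.TorusRowsYM3
import HarnessLib

/-!
# Venture YMGap, tracks Y2 → Y4 — `SU(2)`, `d = 3` TIER-2 rows of `YM3IR.ClusterDomainClustering` (the diameter-weighted
ball `ClusterDomain κ ε₀ ε₁` that Y4 hands over; quarter one-link modulus)

HONEST FRAMING. WHAT THIS IS: a venture file (cell `pub-ymgap`, seat ds-2): HYPOTHESIS-FREE instances of Y4's receiving
conjecture `YM3IR.ClusterDomainClustering ⟨fundamental SU(2), β⋆ = β_W/2, membership in ClusterDomain κ (2ε) ε⟩ suFrobDist κ`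
in `d = 3` — the TIER-2 (no range cut-off, loads weighted by `e^{κ diam X}`) ball, which is the typed hand-over object of
the YM3-IR interface — through `clusterDomainClusteringW_of_oneLinkKRModulus` (`TorusClusteringYM3`) on the tree's quarter
modulus. Weighted Wilson constant in `d = 3`: `e^{κ} c_W = 3 e^{κ} β_W`; rows (exact rationals; `e^{κ}` rational for
`κ = log(6/5), log(3/2)`): `(β_W, κ, ε) = (1/8, log(6/5), 9/50)` [`rhoFR 2 (9/20) (9/25) (9/50) < 1`, new],
`(1/8, log(3/2), 13/100)` [`rhoFR 2 (9/16) (13/50) (13/100) < 1`, the `d = 4` quarter row of `TorusRowsSU2`] and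
`(1/4, log(6/5), 1/50)` [`rhoFR 2 (9/10) (1/25) (1/50) < 1`, the `d = 3` row of `TorusRowsYM3`]. Each: ONE constant `A = 16`,
every law `μ = W.perturbedMeasure (fundamentalRep (Fin 2)) β'`, `0 ≤ β' ≤ β_W/2`, `W ∈ ClusterDomain κ (2ε) ε`, on every torus
`(ℤ/M)³`, `M ≥ 3`, clusters AT RATE `κ` per lattice unit. WHAT THIS IS NOT: strong-coupling ceilings only (`β_W ≤ 1/4`);
nothing about Bałaban's effective actions entering the ball; no continuum statement, no Millennium claim.

## References
* The tree: `YM3IR/Clustering.lean` (`ClusterDomainClustering`), `RobustBall/TorusClusteringYM3.lean`, `RobustBall/TorusRowsSU2.lean`,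
  `RobustBall/TorusRowsYM3.lean`, `Thresholds/QuarterModulusTwoThirds.lean`.
-/

noncomputable section

open MeasureTheory ProbabilityTheory Finset Function Real
open Literature.Probability.LatticeModels Literature.Probability.LatticeModels.DobrushinMetric
open Literature.MathematicalPhysics.QuantumLattice hiding torusNorm
open Literature.MathematicalPhysics.QuantumFieldTheory hiding ZdEdge
open Literature.MathematicalPhysics.QuantumFieldTheory.Balaban1983to89.StrongCouplingDobrushinWindow
  (OneLinkKRModulus OneLinkKRModulusSU2)

namespace Summit.Ventures.YMGap.RobustBall

/-- `e^{9/25} ≤ 1.433337`. [folklore] -/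
theorem exp_036_le : Real.exp (9 / 25) ≤ 1.433337 := by
  have h := Real.exp_bound' (x := 9 / 25) (by norm_num) (by norm_num) (n := 5) (by norm_num)
  refine h.trans ?_
  simp only [Finset.sum_range_succ, Finset.sum_range_zero, Nat.factorial]
  norm_num

/-- Tier-2 `d = 3` row `(β_W, κ, ε) = (1/8, log(6/5), 9/50)`: `rhoFR 2 (9/20) (9/25) (9/50) < 1` (`≈ 0.973`). [folklore] -/
theorem rhoFR_su2_dim3_oneEighth_w65_lt_one : rhoFR 2 (9 / 20) (9 / 25) (9 / 50) < 1 := by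
  refine lt_of_le_of_lt (rhoFR_le_of_bounds (by norm_num) (by norm_num) exp_036_le sqrt_two_le) ?_
  norm_num

/-- **`SU(2)`, `d = 3`, TIER 2: Y4's receiving conjecture on the diameter-weighted ball from the quarter modulus.**
For `0 < β_W ≤ 2/3`, `κ ≥ 0`, `ε₀, ε₁ ≥ 0` and a certified row `rhoFR 2 (3 e^{κ} β_W) ε₀ ε₁ < 1`:
`ClusterDomainClustering ⟨fundamental, β_W/2, ClusterDomain κ ε₀ ε₁⟩ suFrobDist κ` — rate `κ` per lattice unit. [folklore] -/
theorem su2_clusterDomainClusteringW_quarter {βW κ ε₀ ε₁ : ℝ} (hβ0 : 0 < βW) (hβ : βW ≤ 2 / 3) (hκ : 0 ≤ κ)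
    (hε₀ : 0 ≤ ε₀) (hε₁ : 0 ≤ ε₁) (hρ1 : rhoFR 2 (Real.exp κ * (3 * βW)) ε₀ ε₁ < 1) :
    YM3IR.ClusterDomainClustering (G := SUN 2)
      ⟨fundamentalRep (Fin 2), βW / 2, fun _ _ W => W ∈ ClusterDomain κ ε₀ ε₁⟩ suFrobDist κ := by
  have hmod : OneLinkKRModulus 2 (3 * βW / 2) 1 := by
    have h := QuarterModulusTwoThirds.oneLinkKRModulusSU2_of_le_twoThirds hβ
    unfold OneLinkKRModulusSU2 at h
    norm_num at h
    exact h
  have hR : βW / 2 / ((2 : ℕ) : ℝ) * 4 ≤ 3 * βW / 2 := by push_cast; linarith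
  have hcW : Real.exp κ * (1 : ℝ) * (βW / 2 / ((2 : ℕ) : ℝ)) * 12 = Real.exp κ * (3 * βW) := by push_cast; ring
  exact clusterDomainClusteringW_of_oneLinkKRModulus (N := 2) (by norm_num) (βs := βW / 2) zero_le_one hκ hR hmod hε₀ hε₁
    (by rw [hcW]; exact hρ1)

/-- **TIER-2 ROW `d = 3`, `(β_W, κ, ε) = (1/8, log(6/5), 9/50)`**: `ClusterDomainClustering ⟨fundamental SU(2), 1/16,
ClusterDomain (log(6/5)) (9/25) (9/50)⟩ suFrobDist (log(6/5))`; HYPOTHESIS-FREE. [folklore] -/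
theorem su2_clusterDomainClusteringW_dim3_oneEighth_w65 :
    YM3IR.ClusterDomainClustering (G := SUN 2)
      ⟨fundamentalRep (Fin 2), 1 / 16, fun _ _ W => W ∈ ClusterDomain (Real.log (6 / 5)) (9 / 25) (9 / 50)⟩ suFrobDist
      (Real.log (6 / 5)) := by
  have e1 : (1 : ℝ) / 8 / 2 = 1 / 16 := by norm_num
  have e2 : Real.exp (Real.log (6 / 5)) * (3 * ((1 : ℝ) / 8)) = 9 / 20 := by
    rw [Real.exp_log (by norm_num)]; norm_num
  have h := su2_clusterDomainClusteringW_quarter (βW := 1 / 8) (κ := Real.log (6 / 5)) (ε₀ := 9 / 25) (ε₁ := 9 / 50)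
    (by norm_num) (by norm_num) (Real.log_nonneg (by norm_num)) (by norm_num) (by norm_num)
    (by rw [e2]; exact rhoFR_su2_dim3_oneEighth_w65_lt_one)
  rw [e1] at h
  exact h

/-- **TIER-2 ROW `d = 3`, `(β_W, κ, ε) = (1/8, log(3/2), 13/100)`** (rate `log(3/2)`; the row value `rhoFR 2 (9/16) (13/50)
(13/100)` is the `d = 4` quarter row of `TorusRowsSU2`); HYPOTHESIS-FREE. [folklore] -/
theorem su2_clusterDomainClusteringW_dim3_oneEighth_w32 :
    YM3IR.ClusterDomainClustering (G := SUN 2)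
      ⟨fundamentalRep (Fin 2), 1 / 16, fun _ _ W => W ∈ ClusterDomain (Real.log (3 / 2)) (13 / 50) (13 / 100)⟩ suFrobDist
      (Real.log (3 / 2)) := by
  have e1 : (1 : ℝ) / 8 / 2 = 1 / 16 := by norm_num
  have e2 : Real.exp (Real.log (3 / 2)) * (3 * ((1 : ℝ) / 8)) = 9 / 16 := by
    rw [Real.exp_log (by norm_num)]; norm_num
  have h := su2_clusterDomainClusteringW_quarter (βW := 1 / 8) (κ := Real.log (3 / 2)) (ε₀ := 13 / 50) (ε₁ := 13 / 100)
    (by norm_num) (by norm_num) (Real.log_nonneg (by norm_num)) (by norm_num) (by norm_num)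
    (by rw [e2]; exact rhoFR_su2_quarter_oneEighth_lt_one)
  rw [e1] at h
  exact h

/-- **TIER-2 ROW `d = 3`, `(β_W, κ, ε) = (1/4, log(6/5), 1/50)`** (ceiling `β⋆ = 1/8` in tree units, rate `log(6/5)`; row
value `rhoFR 2 (9/10) (1/25) (1/50)` from `TorusRowsYM3`); HYPOTHESIS-FREE. [folklore] -/
theorem su2_clusterDomainClusteringW_dim3_oneQuarter_w65 :
    YM3IR.ClusterDomainClustering (G := SUN 2)
      ⟨fundamentalRep (Fin 2), 1 / 8, fun _ _ W => W ∈ ClusterDomain (Real.log (6 / 5)) (1 / 25) (1 / 50)⟩ suFrobDist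
      (Real.log (6 / 5)) := by
  have e1 : (1 : ℝ) / 4 / 2 = 1 / 8 := by norm_num
  have e2 : Real.exp (Real.log (6 / 5)) * (3 * ((1 : ℝ) / 4)) = 9 / 10 := by
    rw [Real.exp_log (by norm_num)]; norm_num
  have h := su2_clusterDomainClusteringW_quarter (βW := 1 / 4) (κ := Real.log (6 / 5)) (ε₀ := 1 / 25) (ε₁ := 1 / 50)
    (by norm_num) (by norm_num) (Real.log_nonneg (by norm_num)) (by norm_num) (by norm_num)
    (by rw [e2]; exact rhoFR_su2_dim3_threeTenths_lt_one)
  rw [e1] at h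
  exact h

/-- The tier-2 rates are positive: `0 < log(6/5)` and `0 < log(3/2)`. [folklore] -/
theorem log_sixFifths_pos_and_log_threeHalves_pos : 0 < Real.log (6 / 5) ∧ 0 < Real.log (3 / 2) :=
  ⟨Real.log_pos (by norm_num), Real.log_pos (by norm_num)⟩

end Summit.Ventures.YMGap.RobustBall

end
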